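/-
Copyright (c) 2026 the pub-hodgecm-mathlib formalisation cell (harness21).  Prover seat hodgecm-mathlib-B-p04 (g61) as TIER-1 ASSEMBLER of unit (i) «FRAMES» (director s1812 (1);
LEAD T17-31 (R-9)(R-10), directive v1.2 a4e6366df6528969; dealer LH4-plan (g10) WORD #8 (6)): socket module `Cruxes/H413/Lines/F0_P3c_DyRamFourFrame/U1_Frames.lean` of the
«(D-RAM) FOUR-FRAME» road — HOME-first candidate, written to the tree BY WRITE only (registrar A-plan1 (g34) (W1)–(W5)) after the vacuity pass + REF1 box.  2026-09-03.
-/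
import Literature.NumberTheory.Automorphic.UnitaryThreeFourFrameModuleCriterion              -- ★ p854563 (B-p04): A-0 `moduleCriterion_holds : ModuleCriterion`; brings ★ #0a DEFS-1 p854559
import Literature.NumberTheory.Automorphic.UnitaryThreeFourFrameDefectModuleShape             -- ★ p854564 (B-p08): A-1 `defectModuleShape_holds : DefectModuleShape`
import Summits.HodgeConjecture.HodgeConjecture.Theorems.F0P3cDyRamAxisExponentLeTreeDistance   -- ★ p854552 (LH4-p03): A-2↑ `map_smul_toLin'_le_dist_of_reachable` (axis exponent ≤ distance to a reachable stable vertex)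
import Literature.NumberTheory.Automorphic.UnitaryLatticeTreeIsTree                           -- ★ `v_det_antidiagonal_three` (`det Φ₃` is a unit)
import Literature.NumberTheory.Rogawski1990.LocalTransferIdentityCoreDyadicDescent                -- (organ vocabulary, as №2c) `IsLocalGRegular`, `IsLocalNormPair`, `cmDatum`, …
import Literature.NumberTheory.Rogawski1990.ShalikaGermExpansionUnitaryThreeNonsplitCM             -- (organ vocabulary, as №2c)
import Literature.NumberTheory.Rogawski1990.LocalTransferAtOneOfShalikaRankUnramifiedAll           -- (organ vocabulary, as №2c) ★ `localNonsplitEquiv`, `finGammaTwo`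
import Literature.NumberTheory.Automorphic.LocalUnitaryGroupCongr                                  -- (organ vocabulary, as №2c) ★ `galAdicCompletionMap`, `placeForm`
import Summits.HodgeConjecture.HodgeConjecture.Theorems.F0P3cDyRamFrameApartmentVertex             -- ★ p854632 (B-p04): U1 stub 1 PAID `exists_axisStable_vertex`
import Summits.HodgeConjecture.HodgeConjecture.Theorems.F0P3cDyRamFrameClassesDistinct            -- ★ p854652 (B-p04): U1 stub 5 PAID `frameClasses_distinct`
import Summits.HodgeConjecture.HodgeConjecture.Theorems.F0P3cDyRamNormOneSqDepthParity           -- ★ p854642 (B-p04): U1 stub 6 PAID `normOneSq_depth_parity`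
import Summits.HodgeConjecture.HodgeConjecture.Theorems.F0P3cDyRamAxisStableVertexDistLe       -- ★ p854757 (B-p04): U1 stub 2 PAID `exists_axisStable_vertex_dist_le` (A-2↓; bricks ★ p854730 ∕ p854737 ∕ p854750)
import Summits.HodgeConjecture.HodgeConjecture.Theorems.F0P3cDyRamFourFrameData                -- ★ p854865 (F0P3-p01 g30): U1 stub 3 PAID `fourFrameData (N₀)`
import Summits.HodgeConjecture.HodgeConjecture.Theorems.F0P3cDyRamNormPairsIffFrames          -- ★ (LH4-p14 g0; LH4-p12 second seat): U1 stub 4 PAID `normPairs_iff_frames (N₀)`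
import Mathlib.Combinatorics.SimpleGraph.Metric                                                -- `SimpleGraph.dist`, `SimpleGraph.Connected`
import HarnessLib

/-!
# (D-RAM) «FOUR-FRAME» road — TIER-1 SOCKET MODULE `U1_Frames`: unit (i) «module criterion ∕ defect-module shape ∕ axis exponent = tree distance» — ED. 4 (6 of 6 stubs PAID as theorem lines — UNIT U1 SORRY-FREE: ★ p854632, p854757, p854865, `F0P3cDyRamNormPairsIffFrames`, p854652, p854642; signatures byte-identical to ED. 2 8453d915813de9ac)

Cell `pub/hodgecm-mathlib` (D-0151), crux H413 = `stmt-HodgeConjecture-24833`, organ (D-RAM) `stub_DyRamCore` (leaf `Cruxes/H413/Lines/F0_P3c_DyadicPaydown.lean` ED. 4 :147);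
Track A tier 1 (LEAD T17-31 (R-9): one socket module per unit; (R-10) statement discipline).  THIS MODULE = unit (i) of the desk's price sheet (ISSUE 3 b2818d6f9f3155d4
row (i)): «A-0 ∕ A-1 ∕ A-2 over ★ `IsVertexLattice`; A-2 = A-2↑ (tree-free upper bound) + A-2↓ («≥» + exactness, by geodesics — rides on (ii-0))».  Statements are typed
over ★ DEFS-1 names ONLY (`Literature.NumberTheory.Automorphic.UnitaryThreeFourFrame.{ModuleCriterion, DefectModuleShape, AxisExponentEqTreeDistance, AxisStable, frameProj,
IsFourFrameFamily, IsRamifiedQuadraticDatum}` + ★ `IsVertex`, `latticeGraph`); `sorry` occurs ONLY inside the registered `stub_U1_*` (v4: TWO — U1-3 four-frame data, U1-4 norm pairs; U1-1 ∕ U1-2 ∕ U1-5 ∕ U1-6 are ★ theorem lines p854632 ∕ p854757 ∕ p854652 ∕ p854642); the unit assembly is sorry-free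
GIVEN the stubs (its hypothesis form `axisExponentEqTreeDistance_of` is TRIO outright).  No `def`, no `instance`, no notation.

STATE OF UNIT (i) AT WRITING.  A-0 ★ p854563 `moduleCriterion_holds`, A-1 ★ p854564 `defectModuleShape_holds` (both re-exported in §0 BY NAME); A-2↑ ★ p854552
(`map_smul_toLin'_le_dist_of_reachable`: `ϖ^{dist(Λ,M)}·π·Λ ⊆ Λ` for every reachable `π`-stable vertex `M`).  OPEN (v1 view) = the two statements of §1, whose sum is A-2↓ (U1-1 PAID ★ p854632 since; v2 adds §1b, the FRAME stubs of desk INVENTORY-TIER1 v1 56a02b7f4f575bad):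
* `stub_U1_exists_axisStable_vertex` — for every wild datum, four-frame family `f`, frame `b`, slot `i`, SOME vertex `M` of the ★ lattice graph of `(K³, Φ₃)` is `π_i^{(b)}`-stable
  (`AxisStable ϖ (frameProj σ (f b i)) M 0`).  WHY TRUE: the frame's apartment vertex `M = ⊕_j 𝒪·ϖ^{k_j} f_{b,j}` with `2k_j + v(N(f_{b,j})) ∈ {0, 1}` has diagonal Gram matrix with
  entries of valuation `0` or `1`, so `G`, `ϖG⁻¹` are integral (a vertex of type `#{j : v(N f_j) odd}`), and `π_i f_j = δ_ij f_j` makes it `π_i`-stable for every `i`.  Size S.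
* `stub_U1_exists_axisStable_vertex_dist_le` — A-2↓ PROPER: for every vertex `Λ` and exponent `c` with `ϖ^c·π·Λ ⊆ Λ` there is a `π`-stable vertex `M` REACHABLE from `Λ` at
  `dist(Λ, M) ≤ c`.  WHY TRUE (geodesic descent, [Kottwitz1986BaseChangeUnits, §1 pp. 240–241] ∕ [Serre1980Trees, II.1.1]): with `T = ϖ^{c−1}π` (self-adjoint up to a unit),
  `Λ₁ := Λ ∩ T⁻¹Λ` (for `Λ` self-dual) resp. its dual move (for `Λ` of type 2) is a vertex adjacent to (or equal to) `Λ` with `ϖ^{c−1}·π·Λ₁ ⊆ Λ₁` (`π² = π`); iterate `c` times.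
  Size M.  «Exactness `ϖ^{D−1}π_iΛ ⊄ Λ`» of the desk row is the `IsLeast` minimality and needs no separate stub.
ASSEMBLY (§2, sorry-free given the stubs): `AxisExponentEqTreeDistance` BY NAME (DEFS-1 v3 wording, explicit `Connected` hypothesis): the `sInf` of the distances to `π`-stable
vertices is ATTAINED (stub 1 makes the set non-empty, `Nat.sInf_mem`), `ϖ^{that distance}·π·Λ ⊆ Λ` by ★ A-2↑ (`Connected` ⇒ `Reachable`), and every admissible exponent `c` bounds it
from above by stub 2 (`Nat.sInf_le`).  No tier-0 stub is fed directly: unit (i) is consumed by unit (ii-G) «census» (module `U2G_Census`, B-p08 lineage) by import of §0∕§2.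

HONEST LABEL: HC_CM is proved only modulo the 7 printed citations (2 remaining named inputs: hLiu418 = stmt-HodgeConjecture-24832, h413 = stmt-HodgeConjecture-24833) until rung 0
closes; this module moves no verdict and no registry (BY-WRITE line file; registries ×5 unchanged); its `sorry`s (v4: two, both (D-CΔ) frame stubs) are the registered debt of unit (i); A-2 `unitOne_axisExponentEqTreeDistance` is TRIO since v4.
-/

noncomputable section

open scoped Valued WithZero Matrix MatrixGroups

namespace Summit.HodgeConjecture.HodgeConjecture.Cruxes.H413.F0P3cDyRamFourFrame.U1Frames

open MeasureTheory Measure NumberField IsDedekindDomain Topology Filter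
open Literature.NumberTheory.Automorphic Literature.NumberTheory.Automorphic.UnitaryGroup Literature.NumberTheory.Automorphic.IntegralReduction
open Literature.NumberTheory.Automorphic.UnitaryLatticeTree Literature.NumberTheory.Automorphic.HermitianLattice
open Literature.NumberTheory.Rogawski1990 Literature.NumberTheory.GaloisRepresentations
open Literature.NumberTheory.Automorphic.UnitaryThreeFourFrame
open Summit.HodgeConjecture.HodgeConjecture.Cruxes.H413.F0P3cDyRamAxisExponentLeTreeDistance
open scoped Classical

/-! ## §0  The proved part of unit (i), BY NAME (no `sorry`) -/

/-- **A-0 (★ p854563)**: the module criterion `γ_bΛ = Λ ⟺ (α−1, β−1) ∈ M_Λ^{(b)}`. [cite: Kottwitz1986BaseChangeUnits, §1 pp. 240–241] -/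
theorem unitOne_moduleCriterion : ModuleCriterion := moduleCriterion_holds

/-- **A-1 (★ p854564)**: the defect-module shape `M_Λ = 𝔭^{c₁} ⊕ 𝔭^{c₂} + 𝒪(ϖ^{c₁−k}u, ϖ^{c₂−k})`. [cite: Kottwitz1986BaseChangeUnits, §1 pp. 240–241] -/
theorem unitOne_defectModuleShape : DefectModuleShape := defectModuleShape_holds

/-! ## §1  The registered stubs of unit (i) — A-2↓ in two pieces (datum-tied binders, (R-10)(a)) -/

/-- **U1-1 · A `π_i^{(b)}`-STABLE VERTEX EXISTS** (the frame's apartment vertex) — a registered stub of v1, PAID at tier 2 by ★ p854632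
`F0P3cDyRamFrameApartmentVertex.exists_axisStable_vertex` (statement token for token); kept under its stub name as a THEOREM LINE (no `sorry`). [cite: BruhatTits1972, §10] [cite: Serre1980Trees, II.1.1] -/
theorem stub_U1_exists_axisStable_vertex :
    ∀ {K : Type} [Field K] [Valued K ℤᵐ⁰] [CompleteSpace K] (σ : K →+* K) (ϖ : K) (d t : ℕ), IsRamifiedQuadraticDatum σ ϖ d t →
      ∀ (f : Fin 4 → Fin 3 → (Fin 3 → K)), IsFourFrameFamily σ f → ∀ (b : Fin 4) (i : Fin 3),
        ∃ (M : Submodule 𝒪[K] (Fin 3 → K)), IsVertex σ ϖ ((StdForm.antidiagonal 3).over K) M ∧ AxisStable ϖ (frameProj σ (f b i)) M 0 :=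
  Summit.HodgeConjecture.HodgeConjecture.Cruxes.H413.F0P3cDyRamFrameApartmentVertex.exists_axisStable_vertex

/-- **U1-2 · A-2↓: A `π`-STABLE VERTEX WITHIN DISTANCE `c` OF EVERY VERTEX WITH AXIS EXPONENT `≤ c`**: for every wild datum, frame `b`, slot `i`, vertex `Λ` and `c` with
`ϖ^c·π_i^{(b)}·Λ ⊆ Λ`, there is a `π_i^{(b)}`-stable vertex `M` REACHABLE from `Λ` in the lattice graph with `dist(Λ, M) ≤ c` — a registered stub of v1–v3, PAID at tier 2 by ★ p854757
`F0P3cDyRamAxisStableVertexDistLe.exists_axisStable_vertex_dist_le` (statement token for token: one-step lemma ★ p854750 — descent `L ∩ (ϖ^cπ)⁻¹L` at a self-dual vertex ★ p854730,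
ascent `M + (M^♯ ∩ Kf)` at a type-2 vertex ★ p854737 via the line property of `M∕ϖM^♯` —, iterated `c` times into an explicit walk); kept under its stub name as a THEOREM LINE
(no `sorry`). [cite: Kottwitz1986BaseChangeUnits, §1 pp. 240–241] [cite: Serre1980Trees, II.1.1] -/
theorem stub_U1_exists_axisStable_vertex_dist_le :
    ∀ {K : Type} [Field K] [Valued K ℤᵐ⁰] [CompleteSpace K] (σ : K →+* K) (ϖ : K) (d t : ℕ), IsRamifiedQuadraticDatum σ ϖ d t →
      ∀ (f : Fin 4 → Fin 3 → (Fin 3 → K)), IsFourFrameFamily σ f → ∀ (b : Fin 4) (i : Fin 3)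
        (Λ : Submodule 𝒪[K] (Fin 3 → K)) (hΛ : IsVertex σ ϖ ((StdForm.antidiagonal 3).over K) Λ) (c : ℕ),
        AxisStable ϖ (frameProj σ (f b i)) Λ c →
        ∃ (M : Submodule 𝒪[K] (Fin 3 → K)) (hM : IsVertex σ ϖ ((StdForm.antidiagonal 3).over K) M),
          AxisStable ϖ (frameProj σ (f b i)) M 0 ∧ (latticeGraph σ ϖ ((StdForm.antidiagonal 3).over K)).Reachable ⟨Λ, hΛ⟩ ⟨M, hM⟩ ∧
          (latticeGraph σ ϖ ((StdForm.antidiagonal 3).over K)).dist ⟨Λ, hΛ⟩ ⟨M, hM⟩ ≤ c :=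
  Summit.HodgeConjecture.HodgeConjecture.Cruxes.H413.F0P3cDyRamAxisStableVertexDistLe.exists_axisStable_vertex_dist_le


/-! ## §1b  The FRAME stubs of unit (i) — the G-side ∃-data of (D-CΔ) `FourFrameTransferFactor` (★-to-be №2c, law socket v1.4) as three sliced statements + the parity lemma
(desk INVENTORY-TIER1 v1 rows `fourFrame_of_elementDatum` ∕ `frame_conjClasses_distinct` ∕ `eigenTriple_pin`; the pins ride inside the data stub as ∃-binders, (R-10)(c): each stub's
∃-witnesses are its own; the two universal stubs quantify over ANY data of that shape, so U2H's assembly of (D-CΔ) = data (U1-3) + norm pairs (U1-4) + distinctness (U1-5) + parity (U1-6) + its own Δ-row) -/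

/-- **STUB U1-3 · FOUR-FRAME DATA OF A TYPE-(1) ELEMENT NEAR 1** (G-side ∃-half of (D-CΔ), binders VERBATIM from law socket v1.4 §2 up to the literals `t_b`): at a wild place, for every
`G`-regular TYPE-(1) `γ_H ∈ H(L⁺_v)` close enough to `1` there are a four-frame family `f`, CANONICAL norm-one square roots `a, b` (`|a−1|, |b−1| < |2|`) and the norm-one scalar
`z = γ₂ = finGammaTwo` PINNED to `γ_H` with `z a², z b²` the roots at `w` of `χ_g`, depths `(n₁, n₂, n₃)` at threshold `N₀ d` (E), `k` with `2k + d = Σ n + 2`, the GL literals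
`Γ_b = frameElt σ_w f b (a²) (b²)` and GROUP literals `t_b ∈ U(Φ₃)(L⁺_v)` with one-place matrix `z·Γ_b`.  Size M (frames with prescribed norm classes in the split hermitian space;
dyadic square roots of norm-one units near 1; unitarity of `z·Γ_b`; surjectivity of ★ `localNonsplitEquiv`).  CENSUS-SHAPED (desk). [cite: Rogawski1990, §3.6 pp. 28–29; §4.9 p. 54] [cite: Jacobowitz1962, §4] -/
theorem stub_U1_fourFrameData (N₀ : ℕ → ℕ) :
    ∀ (L : Type) [Field L] [NumberField L] [IsCMField L]
      {v : HeightOneSpectrum (𝓞 ↥(maximalRealSubfield L))} (w : UnitaryGroup.PlacesOver L v)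
      (hw : IsCMField.complexConj L • w.1 = w.1) (_he : v.asIdeal.ramificationIdx' w.1.asIdeal ≠ 1)
      (_h2 : ¬ IsUnit (2 : (ValuativeRel.valuation (w.1.adicCompletion L)).integer))
      (ϖ : (w.1.adicCompletion L)) (_hϖ : Valued.v ϖ = WithZero.exp (-1 : ℤ)) (d tE : ℕ) (_hD : IsRamifiedQuadraticDatum (galAdicCompletionMap (L := L) (IsCMField.complexConj L) hw) ϖ d tE),
      ∃ V ∈ 𝓝 (1 : ((UnitaryGroup.cmDatum L 2 (Matrix.of fun i j : Fin 2 => if i.val + j.val + 1 = 2 then (1 : L) else 0)).Local v × (UnitaryGroup.cmDatum L 1 (Matrix.of fun i j : Fin 1 => if i.val + j.val + 1 = 1 then (1 : L) else 0)).Local v)), ∀ γH ∈ V, IsLocalGRegular L v γH →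
        (∃ x : (w.1.adicCompletion L), (((((γH).1.val : GL (Fin 2) (UnitaryGroup.LocalRing L v)).val.map (Pi.evalRingHom (fun w' : UnitaryGroup.PlacesOver L v => w'.1.adicCompletion L) w))).charpoly).IsRoot x) →
        ¬ (∃ (y : ((UnitaryGroup.cmDatum L 2 (Matrix.of fun i j : Fin 2 => if i.val + j.val + 1 = 2 then (1 : L) else 0)).Local v × (UnitaryGroup.cmDatum L 1 (Matrix.of fun i j : Fin 1 => if i.val + j.val + 1 = 1 then (1 : L) else 0)).Local v)) (d' : Fin 2 → (UnitaryGroup.LocalRing L v)ˣ),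
            glDiagonal 2 (UnitaryGroup.LocalRing L v) d' = ((y * γH * y⁻¹).1.val : GL (Fin 2) (UnitaryGroup.LocalRing L v))) →
        ∃ (f : Fin 4 → Fin 3 → (Fin 3 → (w.1.adicCompletion L))) (_ : IsFourFrameFamily (galAdicCompletionMap (L := L) (IsCMField.complexConj L) hw) f)
          (a b z : (w.1.adicCompletion L)) (_ : a * (galAdicCompletionMap (L := L) (IsCMField.complexConj L) hw) a = 1) (_ : b * (galAdicCompletionMap (L := L) (IsCMField.complexConj L) hw) b = 1) (_ : z * (galAdicCompletionMap (L := L) (IsCMField.complexConj L) hw) z = 1)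
          (_ : z = finGammaTwo L v γH w) (_ : ((((γH).1.val : GL (Fin 2) (UnitaryGroup.LocalRing L v)).val.map (Pi.evalRingHom (fun w' : UnitaryGroup.PlacesOver L v => w'.1.adicCompletion L) w))).charpoly.IsRoot (z * (a * a))) (_ : ((((γH).1.val : GL (Fin 2) (UnitaryGroup.LocalRing L v)).val.map (Pi.evalRingHom (fun w' : UnitaryGroup.PlacesOver L v => w'.1.adicCompletion L) w))).charpoly.IsRoot (z * (b * b)))
          (_ : Valued.v (a - 1) < Valued.v (2 : (w.1.adicCompletion L))) (_ : Valued.v (b - 1) < Valued.v (2 : (w.1.adicCompletion L)))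
          (n₁ n₂ n₃ : ℕ) (_ : IsElementDatum (galAdicCompletionMap (L := L) (IsCMField.complexConj L) hw) ϖ (N₀ d) (a * a) (b * b) n₁ n₂ n₃)
          (k : ℕ) (_ : 2 * k + d = n₁ + n₂ + n₃ + 2)
          (Γ : Fin 4 → GL (Fin 3) (w.1.adicCompletion L)) (_ : ∀ b', (Γ b' : Matrix (Fin 3) (Fin 3) (w.1.adicCompletion L)) = frameElt (galAdicCompletionMap (L := L) (IsCMField.complexConj L) hw) f b' (a * a) (b * b))
          (tb : Fin 4 → ((UnitaryGroup.cmDatum L 3 (Matrix.of fun i j : Fin 3 => if i.val + j.val + 1 = 3 then (1 : L) else 0)).Local v)),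
          ∀ b', ((((localNonsplitEquiv (IsCMField.complexConj L) (Matrix.of fun i j : Fin 3 => if i.val + j.val + 1 = 3 then (1 : L) else 0) (IsCMField.complexConj_ne_one L) w hw (tb b') :
              ↥(unitaryGroupOfForm (galAdicCompletionMap (L := L) (IsCMField.complexConj L) hw) (placeForm (Matrix.of fun i j : Fin 3 => if i.val + j.val + 1 = 3 then (1 : L) else 0) w.1))) : GL (Fin 3) (w.1.adicCompletion L)) : Matrix (Fin 3) (Fin 3) (w.1.adicCompletion L))) = z • (Γ b' : Matrix (Fin 3) (Fin 3) (w.1.adicCompletion L)) :=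
  Summit.HodgeConjecture.HodgeConjecture.Cruxes.H413.F0P3cDyRamFourFrameData.fourFrameData N₀  -- PAID ★ p854865

/-- **STUB U1-4 · THE NORM PAIRS OF `γ_H` ARE EXACTLY THE CONJUGATES OF THE FOUR FRAME LITERALS** ((D-CΔ) clause (C)₁, universal over any data of U1-3's shape): for `G`-regular
type-(1) `γ_H` near `1` and ANY four-frame family `f`, norm-one `a, b, z` pinned to `γ_H` (`z = finGammaTwo`, `z a², z b²` the roots of `χ_g` at `w`), regular element datum, GL literals
`Γ_b = frameElt …` and group literals `t_b` with one-place matrix `z·Γ_b`: `IsLocalNormPair L Φ₃ v γ_H t ↔ ∃ b, ⟦t⟧ = ⟦t_b⟧`.  Size M (★ stable-conjugacy tools: the stable class of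
a regular elliptic type-(1) element meets `U(Φ₃)(F_v)` in `|ker(H¹(F,T) → H¹(F,G))| = 4` classes, realised by the four frames). [cite: Rogawski1990, §3.6 pp. 28–29; §4.9 Prop. 4.9.1 (a) p. 55] -/
theorem stub_U1_normPairs_iff_frames (N₀ : ℕ → ℕ) :
    ∀ (L : Type) [Field L] [NumberField L] [IsCMField L]
      {v : HeightOneSpectrum (𝓞 ↥(maximalRealSubfield L))} (w : UnitaryGroup.PlacesOver L v)
      (hw : IsCMField.complexConj L • w.1 = w.1) (_he : v.asIdeal.ramificationIdx' w.1.asIdeal ≠ 1)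
      (_h2 : ¬ IsUnit (2 : (ValuativeRel.valuation (w.1.adicCompletion L)).integer))
      (ϖ : (w.1.adicCompletion L)) (_hϖ : Valued.v ϖ = WithZero.exp (-1 : ℤ)) (d tE : ℕ) (_hD : IsRamifiedQuadraticDatum (galAdicCompletionMap (L := L) (IsCMField.complexConj L) hw) ϖ d tE),
      ∃ V ∈ 𝓝 (1 : ((UnitaryGroup.cmDatum L 2 (Matrix.of fun i j : Fin 2 => if i.val + j.val + 1 = 2 then (1 : L) else 0)).Local v × (UnitaryGroup.cmDatum L 1 (Matrix.of fun i j : Fin 1 => if i.val + j.val + 1 = 1 then (1 : L) else 0)).Local v)), ∀ γH ∈ V, IsLocalGRegular L v γH →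
        (∃ x : (w.1.adicCompletion L), (((((γH).1.val : GL (Fin 2) (UnitaryGroup.LocalRing L v)).val.map (Pi.evalRingHom (fun w' : UnitaryGroup.PlacesOver L v => w'.1.adicCompletion L) w))).charpoly).IsRoot x) →
        ¬ (∃ (y : ((UnitaryGroup.cmDatum L 2 (Matrix.of fun i j : Fin 2 => if i.val + j.val + 1 = 2 then (1 : L) else 0)).Local v × (UnitaryGroup.cmDatum L 1 (Matrix.of fun i j : Fin 1 => if i.val + j.val + 1 = 1 then (1 : L) else 0)).Local v)) (d' : Fin 2 → (UnitaryGroup.LocalRing L v)ˣ),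
            glDiagonal 2 (UnitaryGroup.LocalRing L v) d' = ((y * γH * y⁻¹).1.val : GL (Fin 2) (UnitaryGroup.LocalRing L v))) →
        ∀ (f : Fin 4 → Fin 3 → (Fin 3 → (w.1.adicCompletion L))) (_ : IsFourFrameFamily (galAdicCompletionMap (L := L) (IsCMField.complexConj L) hw) f)
          (a b z : (w.1.adicCompletion L)) (_ : a * (galAdicCompletionMap (L := L) (IsCMField.complexConj L) hw) a = 1) (_ : b * (galAdicCompletionMap (L := L) (IsCMField.complexConj L) hw) b = 1) (_ : z * (galAdicCompletionMap (L := L) (IsCMField.complexConj L) hw) z = 1)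
          (_ : z = finGammaTwo L v γH w) (_ : ((((γH).1.val : GL (Fin 2) (UnitaryGroup.LocalRing L v)).val.map (Pi.evalRingHom (fun w' : UnitaryGroup.PlacesOver L v => w'.1.adicCompletion L) w))).charpoly.IsRoot (z * (a * a))) (_ : ((((γH).1.val : GL (Fin 2) (UnitaryGroup.LocalRing L v)).val.map (Pi.evalRingHom (fun w' : UnitaryGroup.PlacesOver L v => w'.1.adicCompletion L) w))).charpoly.IsRoot (z * (b * b)))
          (n₁ n₂ n₃ : ℕ) (_ : IsElementDatum (galAdicCompletionMap (L := L) (IsCMField.complexConj L) hw) ϖ (N₀ d) (a * a) (b * b) n₁ n₂ n₃)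
          (Γ : Fin 4 → GL (Fin 3) (w.1.adicCompletion L)) (_ : ∀ b', (Γ b' : Matrix (Fin 3) (Fin 3) (w.1.adicCompletion L)) = frameElt (galAdicCompletionMap (L := L) (IsCMField.complexConj L) hw) f b' (a * a) (b * b))
          (tb : Fin 4 → ((UnitaryGroup.cmDatum L 3 (Matrix.of fun i j : Fin 3 => if i.val + j.val + 1 = 3 then (1 : L) else 0)).Local v)) (_ : ∀ b', ((((localNonsplitEquiv (IsCMField.complexConj L) (Matrix.of fun i j : Fin 3 => if i.val + j.val + 1 = 3 then (1 : L) else 0) (IsCMField.complexConj_ne_one L) w hw (tb b') :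
              ↥(unitaryGroupOfForm (galAdicCompletionMap (L := L) (IsCMField.complexConj L) hw) (placeForm (Matrix.of fun i j : Fin 3 => if i.val + j.val + 1 = 3 then (1 : L) else 0) w.1))) : GL (Fin 3) (w.1.adicCompletion L)) : Matrix (Fin 3) (Fin 3) (w.1.adicCompletion L))) = z • (Γ b' : Matrix (Fin 3) (Fin 3) (w.1.adicCompletion L))),
          (∀ t : ((UnitaryGroup.cmDatum L 3 (Matrix.of fun i j : Fin 3 => if i.val + j.val + 1 = 3 then (1 : L) else 0)).Local v), IsLocalNormPair L (Matrix.of fun i j : Fin 3 => if i.val + j.val + 1 = 3 then (1 : L) else 0) v γH t ↔ ∃ b', ConjClasses.mk t = ConjClasses.mk (tb b')) :=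
  Summit.HodgeConjecture.HodgeConjecture.Cruxes.H413.F0P3cDyRamNormPairsIffFrames.normPairs_iff_frames N₀  -- PAID ★ `F0P3cDyRamNormPairsIffFrames`

/-- **U1-5 · THE FOUR FRAME LITERALS ARE PAIRWISE NON-CONJUGATE** (PAID at tier 2 by ★ p854652 `F0P3cDyRamFrameClassesDistinct.frameClasses_distinct`, token for token; THEOREM LINE under its stub name) ((D-CΔ) clause (C)₂; pure G-side, no `γ_H`): for ANY four-frame family `f`, norm-one `a, b, z` with a
regular element datum for `(a², b²)`, GL literals `Γ_b = frameElt …` and group literals `t_b` with one-place matrix `z·Γ_b`: `⟦t_b⟧ = ⟦t_{b′}⟧ → b = b′` (the conjugacy class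
inside the stable class is read off the norm classes of the eigenlines, which the frame index prescribes, H4∕H7). Size S–M. [cite: Rogawski1990, §3.6 pp. 28–29] [cite: Jacobowitz1962, §4] -/
theorem stub_U1_frameClasses_distinct (N₀ : ℕ → ℕ) :
    ∀ (L : Type) [Field L] [NumberField L] [IsCMField L]
      {v : HeightOneSpectrum (𝓞 ↥(maximalRealSubfield L))} (w : UnitaryGroup.PlacesOver L v)
      (hw : IsCMField.complexConj L • w.1 = w.1) (_he : v.asIdeal.ramificationIdx' w.1.asIdeal ≠ 1)
      (_h2 : ¬ IsUnit (2 : (ValuativeRel.valuation (w.1.adicCompletion L)).integer))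
      (ϖ : (w.1.adicCompletion L)) (_hϖ : Valued.v ϖ = WithZero.exp (-1 : ℤ)) (d tE : ℕ) (_hD : IsRamifiedQuadraticDatum (galAdicCompletionMap (L := L) (IsCMField.complexConj L) hw) ϖ d tE),
        ∀ (f : Fin 4 → Fin 3 → (Fin 3 → (w.1.adicCompletion L))) (_ : IsFourFrameFamily (galAdicCompletionMap (L := L) (IsCMField.complexConj L) hw) f)
          (a b z : (w.1.adicCompletion L)) (_ : a * (galAdicCompletionMap (L := L) (IsCMField.complexConj L) hw) a = 1) (_ : b * (galAdicCompletionMap (L := L) (IsCMField.complexConj L) hw) b = 1) (_ : z * (galAdicCompletionMap (L := L) (IsCMField.complexConj L) hw) z = 1)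
          (n₁ n₂ n₃ : ℕ) (_ : IsElementDatum (galAdicCompletionMap (L := L) (IsCMField.complexConj L) hw) ϖ (N₀ d) (a * a) (b * b) n₁ n₂ n₃)
          (Γ : Fin 4 → GL (Fin 3) (w.1.adicCompletion L)) (_ : ∀ b', (Γ b' : Matrix (Fin 3) (Fin 3) (w.1.adicCompletion L)) = frameElt (galAdicCompletionMap (L := L) (IsCMField.complexConj L) hw) f b' (a * a) (b * b))
          (tb : Fin 4 → ((UnitaryGroup.cmDatum L 3 (Matrix.of fun i j : Fin 3 => if i.val + j.val + 1 = 3 then (1 : L) else 0)).Local v)) (_ : ∀ b', ((((localNonsplitEquiv (IsCMField.complexConj L) (Matrix.of fun i j : Fin 3 => if i.val + j.val + 1 = 3 then (1 : L) else 0) (IsCMField.complexConj_ne_one L) w hw (tb b') :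
              ↥(unitaryGroupOfForm (galAdicCompletionMap (L := L) (IsCMField.complexConj L) hw) (placeForm (Matrix.of fun i j : Fin 3 => if i.val + j.val + 1 = 3 then (1 : L) else 0) w.1))) : GL (Fin 3) (w.1.adicCompletion L)) : Matrix (Fin 3) (Fin 3) (w.1.adicCompletion L))) = z • (Γ b' : Matrix (Fin 3) (Fin 3) (w.1.adicCompletion L))),
          (∀ b' b'' : Fin 4, ConjClasses.mk (tb b') = ConjClasses.mk (tb b'') → b' = b'') :=
  Summit.HodgeConjecture.HodgeConjecture.Cruxes.H413.F0P3cDyRamFrameClassesDistinct.frameClasses_distinct N₀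

/-- **U1-6 · DEPTH PARITY OF NORM-ONE SQUARES AT A RAMIFIED QUADRATIC DATUM** (PAID at tier 2 by ★ p854642 `F0P3cDyRamNormOneSqDepthParity.normOneSq_depth_parity`, token for token; THEOREM LINE) (the sheet's «`B_i ∈ ℤ`, parity automatic on `E¹ ∩ (1 + 𝔭^d)`»; discharges (D-CΔ)'s parity binder
`2B = n_i − d + 2 − 2t_E` for whichever slot U2H picks): for `a ∈ E¹` with `a² ≠ 1`, `|a² − 1| = |ϖ|^n ⇒ n ≡ d (mod 2)` (`a² = x²∕σ(x²)`, `x² − σx² ∈ F·(ϖ − σϖ)`, `F^×` has even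
valuations).  Size S. [cite: Serre1979, Ch. V §3] [cite: Rogawski1990, §4.9 p. 55] -/
theorem stub_U1_normOneSq_depth_parity :
    ∀ {K : Type} [Field K] [Valued K ℤᵐ⁰] [CompleteSpace K] (σ : K →+* K) (ϖ : K) (d t : ℕ), IsRamifiedQuadraticDatum σ ϖ d t →
      ∀ (a : K), a * σ a = 1 → a * a ≠ 1 → ∀ n : ℕ, Valued.v (a * a - 1) = Valued.v ϖ ^ n → n % 2 = d % 2 :=
  Summit.HodgeConjecture.HodgeConjecture.Cruxes.H413.F0P3cDyRamNormOneSqDepthParity.normOneSq_depth_parity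

/-! ## §2  The unit assembly: A-2 `AxisExponentEqTreeDistance` BY NAME — sorry-free given the two stubs -/

/-- **UNIT (i) ASSEMBLY, HYPOTHESIS FORM (TRIO)**: the two stub statements imply A-2 `AxisExponentEqTreeDistance` (DEFS-1 v3 wording: under `Connected`, the least axis exponent of
`Λ` for `π_i^{(b)}` IS the `sInf` of the distances from `Λ` to the `π_i^{(b)}`-stable vertices).  ★ A-2↑ `map_smul_toLin'_le_dist_of_reachable` gives the attained value, stub 2 the
lower bound, stub 1 non-emptiness. [cite: Serre1980Trees, II.1.1] [cite: Kottwitz1986BaseChangeUnits, §1 pp. 240–241] -/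
theorem axisExponentEqTreeDistance_of
    (h₁ : ∀ {K : Type} [Field K] [Valued K ℤᵐ⁰] [CompleteSpace K] (σ : K →+* K) (ϖ : K) (d t : ℕ), IsRamifiedQuadraticDatum σ ϖ d t →
      ∀ (f : Fin 4 → Fin 3 → (Fin 3 → K)), IsFourFrameFamily σ f → ∀ (b : Fin 4) (i : Fin 3),
        ∃ (M : Submodule 𝒪[K] (Fin 3 → K)), IsVertex σ ϖ ((StdForm.antidiagonal 3).over K) M ∧ AxisStable ϖ (frameProj σ (f b i)) M 0)
    (h₂ : ∀ {K : Type} [Field K] [Valued K ℤᵐ⁰] [CompleteSpace K] (σ : K →+* K) (ϖ : K) (d t : ℕ), IsRamifiedQuadraticDatum σ ϖ d t →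
      ∀ (f : Fin 4 → Fin 3 → (Fin 3 → K)), IsFourFrameFamily σ f → ∀ (b : Fin 4) (i : Fin 3)
        (Λ : Submodule 𝒪[K] (Fin 3 → K)) (hΛ : IsVertex σ ϖ ((StdForm.antidiagonal 3).over K) Λ) (c : ℕ),
        AxisStable ϖ (frameProj σ (f b i)) Λ c →
        ∃ (M : Submodule 𝒪[K] (Fin 3 → K)) (hM : IsVertex σ ϖ ((StdForm.antidiagonal 3).over K) M),
          AxisStable ϖ (frameProj σ (f b i)) M 0 ∧ (latticeGraph σ ϖ ((StdForm.antidiagonal 3).over K)).Reachable ⟨Λ, hΛ⟩ ⟨M, hM⟩ ∧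
          (latticeGraph σ ϖ ((StdForm.antidiagonal 3).over K)).dist ⟨Λ, hΛ⟩ ⟨M, hM⟩ ≤ c) :
    AxisExponentEqTreeDistance := by
  intro K _ _ _ σ ϖ d t hD hconn f hf b i Λ hΛ
  have hvσ : ∀ a, Valued.v (σ a) = Valued.v a := hD.2.1
  have hH : IsUnit ((StdForm.antidiagonal 3).over K).det := isUnit_iff_ne_zero.2 fun h0 => by
    have h1 := v_det_antidiagonal_three (K := K)
    rw [h0, map_zero] at h1
    exact zero_ne_one h1
  -- the set of distances to `π`-stable vertices is non-empty (stub 1) and its infimum is attained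
  have hne : {n : ℕ | ∃ (M : Submodule 𝒪[K] (Fin 3 → K)) (hM : IsVertex σ ϖ ((StdForm.antidiagonal 3).over K) M),
      AxisStable ϖ (frameProj σ (f b i)) M 0 ∧ (latticeGraph σ ϖ ((StdForm.antidiagonal 3).over K)).dist ⟨Λ, hΛ⟩ ⟨M, hM⟩ = n}.Nonempty := by
    obtain ⟨M, hM, hM0⟩ := h₁ σ ϖ d t hD f hf b i
    exact ⟨_, M, hM, hM0, rfl⟩
  obtain ⟨M, hM, hM0, hMd⟩ := Nat.sInf_mem hne
  refine ⟨?_, fun c hc => ?_⟩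
  · -- attained: `ϖ^{dist(Λ, M)}·π·Λ ⊆ Λ` by ★ A-2↑ (reachability from `Connected`)
    have hr : (latticeGraph σ ϖ ((StdForm.antidiagonal 3).over K)).Reachable ⟨Λ, hΛ⟩ ⟨M, hM⟩ := hconn.preconnected _ _
    have key := map_smul_toLin'_le_dist_of_reachable hvσ hH (frameProj σ (f b i)) hr hM0
    rw [hMd] at key
    exact key
  · -- least: any admissible exponent `c` dominates the distance to SOME stable vertex (stub 2), hence the infimum
    obtain ⟨M', hM', hM'0, -, hdist⟩ := h₂ σ ϖ d t hD f hf b i Λ hΛ c hc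
    have hmem : (latticeGraph σ ϖ ((StdForm.antidiagonal 3).over K)).dist ⟨Λ, hΛ⟩ ⟨M', hM'⟩ ∈
        {n : ℕ | ∃ (M : Submodule 𝒪[K] (Fin 3 → K)) (hM : IsVertex σ ϖ ((StdForm.antidiagonal 3).over K) M),
          AxisStable ϖ (frameProj σ (f b i)) M 0 ∧ (latticeGraph σ ϖ ((StdForm.antidiagonal 3).over K)).dist ⟨Λ, hΛ⟩ ⟨M, hM⟩ = n} :=
      ⟨M', hM', hM'0, rfl⟩
    exact (Nat.sInf_le hmem).trans hdist

/-- **UNIT (i) ASSEMBLY, CLOSED: A-2 `AxisExponentEqTreeDistance`** (`--axioms` = TRIO since v4 — both A-2↓ stubs are ★ theorem lines: `stub_U1_exists_axisStable_vertex` p854632,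
`stub_U1_exists_axisStable_vertex_dist_le` p854757).  Consumed by unit (ii-G) «census» (module `U2G_Census`). [cite: Serre1980Trees, II.1.1] -/
theorem unitOne_axisExponentEqTreeDistance : AxisExponentEqTreeDistance :=
  axisExponentEqTreeDistance_of
    (fun σ ϖ d t hD f hf b i => stub_U1_exists_axisStable_vertex σ ϖ d t hD f hf b i)
    (fun σ ϖ d t hD f hf b i Λ hΛ c hc => stub_U1_exists_axisStable_vertex_dist_le σ ϖ d t hD f hf b i Λ hΛ c hc)

end Summit.HodgeConjecture.HodgeConjecture.Cruxes.H413.F0P3cDyRamFourFrame.U1Frames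

end
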